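import Summits.MatrixMultiplication.OmegaCensus.STPPSmallPatternT2K6SeedWitnessesA
import Summits.MatrixMultiplication.OmegaCensus.STPPSmallPatternT2K6SeedWitnessesB
import Summits.MatrixMultiplication.OmegaCensus.STPPSmallPatternT2K6SeedWitnessesC
import Summits.MatrixMultiplication.OmegaCensus.STPPSmallPatternT2K6SeedWitnessesD
import Summits.MatrixMultiplication.OmegaCensus.STPPSmallPatternT2K6OrderLawCoreB
import Summits.MatrixMultiplication.OmegaCensus.STPPSmallPatternT2K6Order64
import Summits.MatrixMultiplication.OmegaCensus.STPPSmallPatternCyclicRaysT2K6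
import Summits.MatrixMultiplication.OmegaCensus.STPPSmallPatternOnsetLaws

/-!
# ω-census, small STPP pattern `(1,2,2)^k`: THE HOST LAW «EVERY FINITE ABELIAN GROUP OF ORDER ≥ 64 HOSTS (1,2,2)⁶» (kernel)

HONEST FRAMING (pub-omega census; verbatim): lottery ticket; floor = certified bounds/negative ranges.
Census STRUCTURE bookkeeping of the STPP track (seat pub-omega-stpp-3, gen 25; STRUCTURE row B5, column `T2`, `k = 6` UPPER side), not progress on
`ω`: small patterns in small groups bound no exponent.

* `exists_isSTPP_122pow6_of_card_ge_64` — **every finite abelian group of order `≥ 64` admits an STPP family of size pattern `(1,2,2)⁶`.**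
  No `iff` and no onset is claimed: ENG2's `…T2K6Order60` shows hosts of order `60` and `62`, so `64` is NOT the onset of `(1,2,2)⁶`; the law only
  says that from order `64` on nothing fails.

Proof: exponent `≥ 64` ⇒ ENG2's ray `exists_isSTPP_122pow6_of_addOrderOf`; exponent a prime `q ∈ {47, 53, 59, 61}` ⇒ all structure factors are
`q` and there are at least two ⇒ seed `(ℤ/q)²`; exponent `49` ⇒ the factors are `7`'s and `49`'s ⇒ `dom [49, 7]` or `dom [7, 7, 7]` ⇒ seeds
`ℤ/49 × ℤ/7`, `(ℤ/7)³`; every other exponent `E ≤ 63` has all its prime-power divisors `≤ 43` (`primePow_le_43_of_dvd_le_63`), so the capped-multiset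
machinery of `STPP222CubeFrom46` applies at threshold `64`: three or more factors `ℤ/7` ⇒ seed `(ℤ/7)³` directly; otherwise every cap alone gives
`v ^ cap ≥ 64` (`cap_spec64`, `v ≠ 7`), the kernel domination core `hostCore122K6_of_capped` (`…T2K6OrderLawCoreA/B`, 3 303 capped multisets, one
decision per `E ≤ 63`; Python cross-check 0 exceptions) maps onto 81 greedy-minimal prime-power seed types, their decide witnesses
(`…T2K6SeedWitnessesA–D`; the ten non-cyclic order-64 seeds are ENG2's `…T2K6Order64` families, by CRT transport where the coordinates differ),
`exists_emb_of_dom`, transport.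

References: H. Cohn, R. Kleinberg, B. Szegedy, C. Umans, FOCS 2005 (arXiv:math/0511460), Def. 5.1.  Records: HOME `pub-omega-stpp-3-g25/work/t2k6/`.
-/

open Literature.Computability.AlgebraicComplexity Finset

namespace Summit.MatrixMultiplication.OmegaCensus

/-! ## 1. Seeds, caps, prime powers -/

/-- The 81 core seed types host `(1,2,2)⁶` (kernel witnesses). [cite: CohnKleinbergSzegedyUmans2005, Def. 5.1] -/
theorem exists_122pow6_of_mem_hostSeeds122K6 : ∀ s ∈ ([[8, 8], [16, 4], [32, 2], [4, 4, 4], [8, 4, 2], [16, 2, 2], [4, 4, 2, 2], [8, 2, 2, 2], [4, 2, 2, 2, 2], [2, 2, 2, 2, 2, 2], [17, 2, 2], [8, 3, 3], [9, 4, 2], [4, 3, 3, 2], [9, 2, 2, 2], [3, 3, 2, 2, 2], [5, 5, 3], [19, 2, 2], [5, 4, 4], [8, 5, 2], [5, 4, 2, 2], [5, 2, 2, 2, 2], [9, 9], [27, 3], [9, 3, 3], [3, 3, 3, 3], [7, 3, 2, 2], [11, 4, 2], [11, 2, 2, 2], [5, 3, 3, 2], [23, 2, 2], [8, 4, 3],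 [16, 3, 2], [4, 4, 3, 2], [8, 3, 2, 2], [4, 3, 2, 2, 2], [3, 2, 2, 2, 2, 2], [7, 7, 2], [11, 3, 3], [5, 5, 4], [25, 2, 2], [5, 5, 2, 2], [13, 4, 2], [13, 2, 2, 2], [9, 4, 3], [27, 2, 2], [4, 3, 3, 3], [9, 3, 2, 2], [3, 3, 3, 2, 2], [7, 4, 4], [8, 7, 2], [7, 4, 2, 2], [7, 2, 2, 2, 2], [29, 2, 2], [13, 3, 3], [5, 4, 3, 2], [5, 3, 2, 2, 2], [11, 11], [31, 2, 2], [25, 5], [5, 5, 5], [7, 3, 3, 2], [9, 5, 3], [5, 3, 3, 3], [7, 7, 3], [17, 3, 3], [13, 13], [19, 3, 3], [7, 5, 5], [9, 7, 3], [7, 3, 3, 3], [7, 7, 5], [11, 5, 5], [17, 17], [19, 19], [23, 23], [29, 29], [31, 31], [37, 37], [41, 41], [43, 43]] : List (List ℕ)),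
    ∃ A B C : Fin 6 → Finset (SeedType s), IsSTPP A B C ∧ ∀ i, (A i).card = 1 ∧ (B i).card = 2 ∧ (C i).card = 2 := by
  intro s hs
  simp only [List.mem_cons, List.mem_nil_iff, or_false] at hs
  rcases hs with rfl | rfl | rfl | rfl | rfl | rfl | rfl | rfl | rfl | rfl | rfl | rfl | rfl | rfl | rfl | rfl | rfl | rfl | rfl | rfl | rfl | rfl | rfl | rfl | rfl | rfl | rfl | rfl | rfl | rfl | rfl | rfl | rfl | rfl | rfl | rfl | rfl | rfl | rfl | rfl | rfl | rfl | rfl | rfl | rfl | rfl | rfl | rfl | rfl | rfl | rfl | rfl | rfl | rfl | rfl | rfl | rfl | rfl | rfl | rfl | rfl | rfl | rfl | rfl | rfl | rfl | rfl | rfl | rfl | rfl | rfl | rfl | rfl | rfl | rfl | rfl | rfl | rfl | rfl | rfl | rfl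
  · exact exists_isSTPP_122pow6_zmod8_zmod8
  · exact exists_isSTPP_122pow6_seed_16_4
  · exact exists_isSTPP_122pow6_seed_32_2
  · exact exists_isSTPP_122pow6_zmod4_zmod4_zmod4
  · exact exists_isSTPP_122pow6_seed_8_4_2
  · exact exists_isSTPP_122pow6_seed_16_2_2
  · exact exists_isSTPP_122pow6_seed_4_4_2_2
  · exact exists_isSTPP_122pow6_seed_8_2_2_2
  · exact exists_isSTPP_122pow6_seed_4_2_2_2_2
  · exact exists_isSTPP_122pow6_zmod2_zmod2_zmod2_zmod2_zmod2_zmod2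
  · exact exists_isSTPP_122pow6_seed_17_2_2
  · exact exists_isSTPP_122pow6_seed_8_3_3
  · exact exists_isSTPP_122pow6_seed_9_4_2
  · exact exists_isSTPP_122pow6_seed_4_3_3_2
  · exact exists_isSTPP_122pow6_seed_9_2_2_2
  · exact exists_isSTPP_122pow6_seed_3_3_2_2_2
  · exact exists_isSTPP_122pow6_seed_5_5_3
  · exact exists_isSTPP_122pow6_seed_19_2_2
  · exact exists_isSTPP_122pow6_seed_5_4_4
  · exact exists_isSTPP_122pow6_seed_8_5_2
  · exact exists_isSTPP_122pow6_seed_5_4_2_2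
  · exact exists_isSTPP_122pow6_seed_5_2_2_2_2
  · exact exists_isSTPP_122pow6_seed_9_9
  · exact exists_isSTPP_122pow6_seed_27_3
  · exact exists_isSTPP_122pow6_seed_9_3_3
  · exact exists_isSTPP_122pow6_seed_3_3_3_3
  · exact exists_isSTPP_122pow6_seed_7_3_2_2
  · exact exists_isSTPP_122pow6_seed_11_4_2
  · exact exists_isSTPP_122pow6_seed_11_2_2_2
  · exact exists_isSTPP_122pow6_seed_5_3_3_2
  · exact exists_isSTPP_122pow6_seed_23_2_2
  · exact exists_isSTPP_122pow6_seed_8_4_3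
  · exact exists_isSTPP_122pow6_seed_16_3_2
  · exact exists_isSTPP_122pow6_seed_4_4_3_2
  · exact exists_isSTPP_122pow6_seed_8_3_2_2
  · exact exists_isSTPP_122pow6_seed_4_3_2_2_2
  · exact exists_isSTPP_122pow6_seed_3_2_2_2_2_2
  · exact exists_isSTPP_122pow6_seed_7_7_2
  · exact exists_isSTPP_122pow6_seed_11_3_3
  · exact exists_isSTPP_122pow6_seed_5_5_4
  · exact exists_isSTPP_122pow6_seed_25_2_2
  · exact exists_isSTPP_122pow6_seed_5_5_2_2
  · exact exists_isSTPP_122pow6_seed_13_4_2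
  · exact exists_isSTPP_122pow6_seed_13_2_2_2
  · exact exists_isSTPP_122pow6_seed_9_4_3
  · exact exists_isSTPP_122pow6_seed_27_2_2
  · exact exists_isSTPP_122pow6_seed_4_3_3_3
  · exact exists_isSTPP_122pow6_seed_9_3_2_2
  · exact exists_isSTPP_122pow6_seed_3_3_3_2_2
  · exact exists_isSTPP_122pow6_seed_7_4_4
  · exact exists_isSTPP_122pow6_seed_8_7_2
  · exact exists_isSTPP_122pow6_seed_7_4_2_2
  · exact exists_isSTPP_122pow6_seed_7_2_2_2_2
  · exact exists_isSTPP_122pow6_seed_29_2_2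
  · exact exists_isSTPP_122pow6_seed_13_3_3
  · exact exists_isSTPP_122pow6_seed_5_4_3_2
  · exact exists_isSTPP_122pow6_seed_5_3_2_2_2
  · exact exists_isSTPP_122pow6_seed_11_11
  · exact exists_isSTPP_122pow6_seed_31_2_2
  · exact exists_isSTPP_122pow6_seed_25_5
  · exact exists_isSTPP_122pow6_seed_5_5_5
  · exact exists_isSTPP_122pow6_seed_7_3_3_2
  · exact exists_isSTPP_122pow6_seed_9_5_3
  · exact exists_isSTPP_122pow6_seed_5_3_3_3
  · exact exists_isSTPP_122pow6_seed_7_7_3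
  · exact exists_isSTPP_122pow6_seed_17_3_3
  · exact exists_isSTPP_122pow6_seed_13_13
  · exact exists_isSTPP_122pow6_seed_19_3_3
  · exact exists_isSTPP_122pow6_seed_7_5_5
  · exact exists_isSTPP_122pow6_seed_9_7_3
  · exact exists_isSTPP_122pow6_seed_7_3_3_3
  · exact exists_isSTPP_122pow6_seed_7_7_5
  · exact exists_isSTPP_122pow6_seed_11_5_5
  · exact exists_isSTPP_122pow6_seed_17_17
  · exact exists_isSTPP_122pow6_seed_19_19
  · exact exists_isSTPP_122pow6_seed_23_23
  · exact exists_isSTPP_122pow6_seed_29_29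
  · exact exists_isSTPP_122pow6_seed_31_31
  · exact exists_isSTPP_122pow6_seed_37_37
  · exact exists_isSTPP_122pow6_seed_41_41
  · exact exists_isSTPP_122pow6_seed_43_43

/-- The caps are large enough for the threshold `64` except at `7`: `v ^ (multiplicity of v in C_E) ≥ 64` for every prime power `v ≠ 7` of
`ppList` dividing `1 ≤ E ≤ 63` (kernel). -/
theorem cap_spec64 : ∀ E ∈ List.range' 1 63, ∀ v ∈ ppList, v ∣ E → v ≠ 7 → 64 ≤ v ^ Multiset.count v (capMS (capList E)) := by
  decide +kernel

/-- The cap of `7` is exactly two whenever `7 ∣ E`, `1 ≤ E ≤ 63` (kernel). -/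
theorem cap7_eq_two : ∀ E ∈ List.range' 1 63, 7 ∣ E → Multiset.count 7 (capMS (capList E)) = 2 := by
  decide +kernel

/-- Prime powers between `44` and `63` (kernel table): a power `p ^ k` in that window with `p < 64`, `k < 6` is one of `47, 49, 53, 59, 61`, unless
`p` has a proper divisor among `2, 3, 5, 7`. -/
theorem primePow_window_44_63 : ∀ p ∈ List.range 64, ∀ k ∈ List.range 6, 44 ≤ p ^ k → p ^ k ≤ 63 →
    (p ^ k = 47 ∨ p ^ k = 49 ∨ p ^ k = 53 ∨ p ^ k = 59 ∨ p ^ k = 61) ∨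
      (p % 2 = 0 ∧ p ≠ 2) ∨ (p % 3 = 0 ∧ p ≠ 3) ∨ (p % 5 = 0 ∧ p ≠ 5) ∨ (p % 7 = 0 ∧ p ≠ 7) := by
  decide +kernel

/-- A prime power dividing some `E ≤ 63`, `E ∉ {47, 49, 53, 59, 61}`, is `≤ 43`. -/
theorem primePow_le_43_of_dvd_le_63 {p k E : ℕ} (hp : p.Prime) (hE : E ≤ 63) (hE0 : 0 < E)
    (h47 : E ≠ 47) (h49 : E ≠ 49) (h53 : E ≠ 53) (h59 : E ≠ 59) (h61 : E ≠ 61) (h : p ^ k ∣ E) : p ^ k ≤ 43 := by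
  have hle : p ^ k ≤ 63 := le_trans (Nat.le_of_dvd hE0 h) hE
  by_contra hgt
  have h44 : 44 ≤ p ^ k := by omega
  have hk0 : k ≠ 0 := by rintro rfl; simp at h44
  have hp64 : p < 64 := lt_of_le_of_lt (le_trans (Nat.le_self_pow hk0 p) hle) (by norm_num)
  have hk6 : k < 6 := by
    by_contra hk
    have : 2 ^ 6 ≤ p ^ k := le_trans (Nat.pow_le_pow_right (by norm_num) (by omega)) (Nat.pow_le_pow_left hp.two_le k)
    omega
  have hcomp : ∀ d, p % d = 0 ∧ p ≠ d → d ≠ 1 → False := fun d ⟨hd, hne⟩ hd1 => by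
    rcases hp.eq_one_or_self_of_dvd d (Nat.dvd_of_mod_eq_zero hd) with h1 | h2
    · exact hd1 h1
    · exact hne h2.symm
  rcases primePow_window_44_63 p (List.mem_range.2 hp64) k (List.mem_range.2 hk6) h44 hle with hq | hd | hd | hd | hd
  · obtain ⟨c, hc⟩ := h
    rcases hq with hq | hq | hq | hq | hq <;> rw [hq] at hc <;> omega
  · exact hcomp 2 hd (by norm_num)
  · exact hcomp 3 hd (by norm_num)
  · exact hcomp 5 hd (by norm_num)
  · exact hcomp 7 hd (by norm_num)

/-! ## 2. The product forms -/

/-- Generic exponents: `E ≤ 63`, `E ∉ {47, 49, 53, 59, 61}`. [cite: CohnKleinbergSzegedyUmans2005, Def. 5.1] -/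
theorem exists_isSTPP_122pow6_pi {ι : Type} [Fintype ι] [DecidableEq ι] (p e : ι → ℕ)
    (hp : ∀ i, (p i).Prime) {E : ℕ} (hE1 : 1 ≤ E) (hE63 : E ≤ 63)
    (h47 : E ≠ 47) (h49 : E ≠ 49) (h53 : E ≠ 53) (h59 : E ≠ 59) (h61 : E ≠ 61) (hdvd : ∀ i, p i ^ e i ∣ E)
    (hcard : 64 ≤ ∏ i, p i ^ e i)
    (w777 : ∃ A B C : Fin 6 → Finset (SeedType [7, 7, 7]), IsSTPP A B C ∧ ∀ i, (A i).card = 1 ∧ (B i).card = 2 ∧ (C i).card = 2) :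
    ∃ A B C : Fin 6 → Finset (Π i, ZMod (p i ^ e i)), IsSTPP A B C ∧
      ∀ i, (A i).card = 1 ∧ (B i).card = 2 ∧ (C i).card = 2 := by
  have hq0 : ∀ i, p i ^ e i ≠ 0 := fun i => pow_ne_zero _ (hp i).ne_zero
  set M : Multiset ℕ := (Finset.univ.filter fun i => 0 < e i).val.map fun i => p i ^ e i with hM
  have hprod : 64 ≤ M.prod := by
    have : M.prod = ∏ i, p i ^ e i := by
      rw [hM, ← Finset.prod_eq_multiset_prod]
      exact Finset.prod_filter_of_ne fun i _ hi => Nat.pos_of_ne_zero fun h0 => hi (by rw [h0, pow_zero])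
    rw [this]; exact hcard
  have hmem : ∀ a ∈ M, a ∈ ppList ∧ a ∣ E := by
    intro a ha
    obtain ⟨i, hi, rfl⟩ := Multiset.mem_map.1 ha
    have hi' : 0 < e i := (Finset.mem_filter.1 hi).2
    exact ⟨pow_mem_ppList (hp i) hi' (le_trans (primePow_le_43_of_dvd_le_63 (hp i) hE63 (by omega) h47 h49 h53 h59 h61 (hdvd i))
      (by norm_num)), hdvd i⟩
  -- three or more factors `ℤ/7`: the seed `(ℤ/7)³` embeds directly
  by_cases h7 : 3 ≤ Multiset.count 7 M
  · have hD : dom [7, 7, 7] M = true :=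
      dom_mono [7, 7, 7] (M' := Multiset.replicate 3 7) (Multiset.le_count_iff_replicate_le.1 h7) (by decide)
    obtain ⟨φ, hφ, -⟩ := exists_emb_of_dom (fun i => p i ^ e i) hq0 [7, 7, 7] _ hD
    exact exists_isSTPP_122_of_injective φ hφ w777
  have hEI : E ∈ List.range' 1 63 := List.mem_range'_1.2 ⟨hE1, by omega⟩
  set C := capMS (capList E) with hC
  -- capping keeps the product ≥ 64 (every cap other than 7's alone gives ≥ 64; the cap of 7 is not exceeded)
  have hcapd : 64 ≤ (M ∩ C).prod := by
    by_cases hle : M ≤ C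
    · have : M ∩ C = M := le_antisymm Multiset.inter_le_left (Multiset.le_inter le_rfl hle)
      rw [this]; exact hprod
    · rw [Multiset.le_iff_count] at hle
      push Not at hle
      obtain ⟨a, ha⟩ := hle
      have haM : a ∈ M := Multiset.count_pos.1 (by omega)
      have ha7 : a ≠ 7 := by
        rintro rfl
        have h72 := cap7_eq_two E hEI (hmem 7 haM).2
        rw [← hC] at h72
        omega
      have hcnt : Multiset.count a (M ∩ C) = Multiset.count a C := by
        rw [Multiset.count_inter]; omega
      have hrep : Multiset.replicate (Multiset.count a C) a ≤ M ∩ C :=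
        Multiset.le_count_iff_replicate_le.1 hcnt.ge
      obtain ⟨R, hR⟩ := Multiset.le_iff_exists_add.1 hrep
      have hRpos : ∀ x ∈ R, 1 ≤ x := fun x hx =>
        one_le_of_mem_ppList (hmem x (Multiset.mem_of_le Multiset.inter_le_left (hR ▸ Multiset.mem_add.2 (Or.inr hx)))).1
      have h1 : 1 ≤ R.prod := Multiset.one_le_prod_of_one_le hRpos
      rw [hR, Multiset.prod_add, Multiset.prod_replicate]
      calc 64 ≤ a ^ Multiset.count a C := cap_spec64 E hEI a (hmem a haM).1 (hmem a haM).2 ha7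
        _ = a ^ Multiset.count a C * 1 := (mul_one _).symm
        _ ≤ a ^ Multiset.count a C * R.prod := Nat.mul_le_mul_left _ h1
  have hsub : M ∩ C ∈ subMS (capList E) := mem_subMS_of_le _ _ Multiset.inter_le_right
  obtain ⟨s, hs, hD⟩ := hostCore122K6_of_capped E hEI (M ∩ C) hsub hcapd
  obtain ⟨φ, hφ, -⟩ := exists_emb_of_dom (fun i => p i ^ e i) hq0 s _ (dom_mono s Multiset.inter_le_left hD)
  exact exists_isSTPP_122_of_injective φ hφ (exists_122pow6_of_mem_hostSeeds122K6 s hs)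

/-- Prime exponent `q < 64`: all nontrivial factors are `ℤ/q`, at least two of them, so `(ℤ/q)²` embeds.
[cite: CohnKleinbergSzegedyUmans2005, Def. 5.1] -/
theorem exists_isSTPP_122pow6_pi_prime {ι : Type} [Fintype ι] [DecidableEq ι] (p e : ι → ℕ)
    (hp : ∀ i, (p i).Prime) (q : ℕ) (hq : q.Prime) (hq64 : q < 64) (hdvd : ∀ i, p i ^ e i ∣ q) (hcard : 64 ≤ ∏ i, p i ^ e i)
    (hdom : dom [q, q] (Multiset.replicate 2 q) = true)
    (w : ∃ A B C : Fin 6 → Finset (SeedType [q, q]), IsSTPP A B C ∧ ∀ i, (A i).card = 1 ∧ (B i).card = 2 ∧ (C i).card = 2) :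
    ∃ A B C : Fin 6 → Finset (Π i, ZMod (p i ^ e i)), IsSTPP A B C ∧
      ∀ i, (A i).card = 1 ∧ (B i).card = 2 ∧ (C i).card = 2 := by
  have hq0 : ∀ i, p i ^ e i ≠ 0 := fun i => pow_ne_zero _ (hp i).ne_zero
  set M : Multiset ℕ := (Finset.univ.filter fun i => 0 < e i).val.map fun i => p i ^ e i with hM
  have hprodeq : M.prod = ∏ i, p i ^ e i := by
    rw [hM, ← Finset.prod_eq_multiset_prod]
    exact Finset.prod_filter_of_ne fun i _ hi => Nat.pos_of_ne_zero fun h0 => hi (by rw [h0, pow_zero])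
  have hall : ∀ a ∈ M, a = q := by
    intro a ha
    obtain ⟨i, hi, rfl⟩ := Multiset.mem_map.1 ha
    have hi' : 0 < e i := (Finset.mem_filter.1 hi).2
    rcases (Nat.dvd_prime hq).1 (hdvd i) with h1 | hq'
    · exfalso
      have : 1 < p i ^ e i := Nat.one_lt_pow hi'.ne' (hp i).one_lt
      omega
    · exact hq'
  obtain ⟨c, hc⟩ : ∃ c, M = Multiset.replicate c q := ⟨_, Multiset.eq_replicate_card.2 hall⟩
  have hc2 : 2 ≤ c := by
    by_contra hlt
    have : M.prod ≤ q := by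
      rw [hc, Multiset.prod_replicate]
      calc q ^ c ≤ q ^ 1 := Nat.pow_le_pow_right hq.pos (by omega)
        _ = q := pow_one q
    rw [hprodeq] at this; omega
  have hD : dom [q, q] M = true :=
    dom_mono [q, q] (M' := Multiset.replicate 2 q) (by rw [hc]; exact (Multiset.replicate_le_replicate q).2 hc2) hdom
  obtain ⟨φ, hφ, -⟩ := exists_emb_of_dom (fun i => p i ^ e i) hq0 [q, q] _ hD
  exact exists_isSTPP_122_of_injective φ hφ w

/-- Exponent `49`: the nontrivial factors are `7`'s and `49`'s with product `≥ 64`, so `ℤ/49 × ℤ/7` or `(ℤ/7)³` embeds.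
[cite: CohnKleinbergSzegedyUmans2005, Def. 5.1] -/
theorem exists_isSTPP_122pow6_pi_49 {ι : Type} [Fintype ι] [DecidableEq ι] (p e : ι → ℕ)
    (hp : ∀ i, (p i).Prime) (hdvd : ∀ i, p i ^ e i ∣ 49) (hcard : 64 ≤ ∏ i, p i ^ e i)
    (w497 : ∃ A B C : Fin 6 → Finset (SeedType [49, 7]), IsSTPP A B C ∧ ∀ i, (A i).card = 1 ∧ (B i).card = 2 ∧ (C i).card = 2)
    (w777 : ∃ A B C : Fin 6 → Finset (SeedType [7, 7, 7]), IsSTPP A B C ∧ ∀ i, (A i).card = 1 ∧ (B i).card = 2 ∧ (C i).card = 2) :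
    ∃ A B C : Fin 6 → Finset (Π i, ZMod (p i ^ e i)), IsSTPP A B C ∧
      ∀ i, (A i).card = 1 ∧ (B i).card = 2 ∧ (C i).card = 2 := by
  have hq0 : ∀ i, p i ^ e i ≠ 0 := fun i => pow_ne_zero _ (hp i).ne_zero
  set M : Multiset ℕ := (Finset.univ.filter fun i => 0 < e i).val.map fun i => p i ^ e i with hM
  have hprodeq : M.prod = ∏ i, p i ^ e i := by
    rw [hM, ← Finset.prod_eq_multiset_prod]
    exact Finset.prod_filter_of_ne fun i _ hi => Nat.pos_of_ne_zero fun h0 => hi (by rw [h0, pow_zero])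
  have hall : ∀ a ∈ M, a = 7 ∨ a = 49 := by
    intro a ha
    obtain ⟨i, hi, rfl⟩ := Multiset.mem_map.1 ha
    have hi' : 0 < e i := (Finset.mem_filter.1 hi).2
    have h1 : 1 < p i ^ e i := Nat.one_lt_pow hi'.ne' (hp i).one_lt
    have h49 : (49 : ℕ) = 7 ^ 2 := by norm_num
    obtain ⟨j, hj, hje⟩ := (Nat.dvd_prime_pow (by norm_num : Nat.Prime 7)).1 (h49 ▸ hdvd i)
    rw [hje] at h1 ⊢
    interval_cases j
    · simp at h1
    · exact Or.inl (by norm_num)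
    · exact Or.inr (by norm_num)
  have hle49 : ∀ a ∈ M, a ≤ 49 := fun a ha => by rcases hall a ha with h | h <;> omega
  have h7dvd : ∀ a ∈ M, 7 ∣ a := fun a ha => by
    rcases hall a ha with h | h
    · rw [h]
    · rw [h]; exact ⟨7, by norm_num⟩
  -- at least two nontrivial factors
  have hcard2 : 2 ≤ Multiset.card M := by
    by_contra hlt
    have hprod : M.prod ≤ 49 := by
      rcases Nat.lt_or_ge (Multiset.card M) 1 with h0 | h1
      · have hM0 : M = 0 := Multiset.card_eq_zero.1 (by omega)
        rw [hM0]; simp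
      · obtain ⟨a, ha⟩ := Multiset.card_eq_one.1 (by omega : Multiset.card M = 1)
        rw [ha, Multiset.prod_singleton]; exact hle49 a (by rw [ha]; exact Multiset.mem_singleton_self a)
    rw [hprodeq] at hprod; omega
  by_cases h49M : (49 : ℕ) ∈ M
  · -- `dom [49, 7]`: the `49`, then any other factor
    have hcardE : 1 ≤ Multiset.card (M.erase 49) := by rw [Multiset.card_erase_of_mem h49M, Nat.pred_eq_sub_one]; omega
    obtain ⟨y, hy⟩ := Multiset.card_pos_iff_exists_mem.1 (by omega : 0 < Multiset.card (M.erase 49))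
    have hD : dom [49, 7] M = true :=
      dom_cons.2 ⟨49, h49M, dvd_rfl, dom_cons.2 ⟨y, hy, h7dvd y (Multiset.mem_of_mem_erase hy), rfl⟩⟩
    obtain ⟨φ, hφ, -⟩ := exists_emb_of_dom (fun i => p i ^ e i) hq0 [49, 7] _ hD
    exact exists_isSTPP_122_of_injective φ hφ w497
  · -- all factors are `7`: at least three of them
    have hall7 : ∀ a ∈ M, a = 7 := fun a ha => by
      rcases hall a ha with h | h
      · exact h
      · exact absurd (h ▸ ha) h49M
    obtain ⟨c, hc⟩ : ∃ c, M = Multiset.replicate c 7 := ⟨_, Multiset.eq_replicate_card.2 hall7⟩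
    have hc3 : 3 ≤ c := by
      by_contra hlt
      have : M.prod ≤ 49 := by
        rw [hc, Multiset.prod_replicate]
        calc 7 ^ c ≤ 7 ^ 2 := Nat.pow_le_pow_right (by norm_num) (by omega)
          _ = 49 := by norm_num
      rw [hprodeq] at this; omega
    have hD : dom [7, 7, 7] M = true :=
      dom_mono [7, 7, 7] (M' := Multiset.replicate 3 7) (by rw [hc]; exact (Multiset.replicate_le_replicate 7).2 hc3) (by decide)
    obtain ⟨φ, hφ, -⟩ := exists_emb_of_dom (fun i => p i ^ e i) hq0 [7, 7, 7] _ hD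
    exact exists_isSTPP_122_of_injective φ hφ w777

/-! ## 3. The law -/

/-- **THE HOST LAW: every finite abelian group of order `≥ 64` admits an STPP family of size pattern `(1,2,2)⁶`** (CKSU Def. 5.1, tree `IsSTPP`).
Not an onset statement (order-`60`/`62` hosts exist); no `ω` bound follows. [cite: CohnKleinbergSzegedyUmans2005, Def. 5.1] -/
theorem exists_isSTPP_122pow6_of_card_ge_64 {G : Type*} [AddCommGroup G] [Finite G] (hG : 64 ≤ Nat.card G) :
    ∃ A B C : Fin 6 → Finset G, IsSTPP A B C ∧ ∀ i, (A i).card = 1 ∧ (B i).card = 2 ∧ (C i).card = 2 := by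
  classical
  by_cases hexp : 64 ≤ AddMonoid.exponent G
  · obtain ⟨g, hg⟩ := AddMonoid.exists_addOrderOf_eq_exponent (AddMonoid.ExponentExists.of_finite (G := G))
    exact exists_isSTPP_122pow6_of_addOrderOf g (by rw [hg]; exact hexp)
  obtain ⟨ι, _, p, hp, e, ⟨g⟩⟩ := AddCommGroup.equiv_directSum_zmod_of_finite G
  let f : G ≃+ (Π i, ZMod (p i ^ e i)) :=
    g.trans (DirectSum.linearEquivFunOnFintype ℕ ι (fun i => ZMod (p i ^ e i))).toAddEquiv
  have hE1 : 1 ≤ AddMonoid.exponent G := Nat.pos_of_ne_zero AddMonoid.exponent_ne_zero_of_finite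
  have hdvd : ∀ i, p i ^ e i ∣ AddMonoid.exponent G := fun i => by
    have hinj : Function.Injective (AddMonoidHom.single (fun j => ZMod (p j ^ e j)) i) :=
      Pi.single_injective (M := fun j => ZMod (p j ^ e j)) i
    have h1 : addOrderOf (f.symm (AddMonoidHom.single (fun j => ZMod (p j ^ e j)) i 1)) = p i ^ e i := by
      rw [AddEquiv.addOrderOf_eq, addOrderOf_injective _ hinj, ZMod.addOrderOf_one]
    rw [← h1]
    exact AddMonoid.addOrder_dvd_exponent _
  have hcard : 64 ≤ ∏ i, p i ^ e i := by
    have : Nat.card G = ∏ i, p i ^ e i := by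
      rw [Nat.card_congr f.toEquiv, Nat.card_pi]
      simp [Nat.card_zmod]
    rw [← this]; exact hG
  have fin : (∃ A B C : Fin 6 → Finset (Π i, ZMod (p i ^ e i)), IsSTPP A B C ∧ ∀ i, (A i).card = 1 ∧ (B i).card = 2 ∧ (C i).card = 2) →
      ∃ A B C : Fin 6 → Finset G, IsSTPP A B C ∧ ∀ i, (A i).card = 1 ∧ (B i).card = 2 ∧ (C i).card = 2 :=
    fun h => exists_isSTPP_122_of_injective f.symm.toAddMonoidHom f.symm.injective h
  set E := AddMonoid.exponent G with hEdef
  by_cases h47 : E = 47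
  · exact fin (exists_isSTPP_122pow6_pi_prime p e hp 47 (by norm_num) (by norm_num) (fun i => h47 ▸ hdvd i) hcard (by decide)
      exists_isSTPP_122pow6_seed_47_47)
  by_cases h53 : E = 53
  · exact fin (exists_isSTPP_122pow6_pi_prime p e hp 53 (by norm_num) (by norm_num) (fun i => h53 ▸ hdvd i) hcard (by decide)
      exists_isSTPP_122pow6_seed_53_53)
  by_cases h59 : E = 59
  · exact fin (exists_isSTPP_122pow6_pi_prime p e hp 59 (by norm_num) (by norm_num) (fun i => h59 ▸ hdvd i) hcard (by decide)
      exists_isSTPP_122pow6_seed_59_59)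
  by_cases h61 : E = 61
  · exact fin (exists_isSTPP_122pow6_pi_prime p e hp 61 (by norm_num) (by norm_num) (fun i => h61 ▸ hdvd i) hcard (by decide)
      exists_isSTPP_122pow6_seed_61_61)
  by_cases h49 : E = 49
  · exact fin (exists_isSTPP_122pow6_pi_49 p e hp (fun i => h49 ▸ hdvd i) hcard exists_isSTPP_122pow6_seed_49_7 exists_isSTPP_122pow6_seed_7_7_7)
  exact fin (exists_isSTPP_122pow6_pi p e hp hE1 (by omega) h47 h49 h53 h59 h61 hdvd hcard exists_isSTPP_122pow6_seed_7_7_7)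

end Summit.MatrixMultiplication.OmegaCensus
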